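import Summits.QuantumAdvantage.QuantumAdvantage.Theorems.CharDialPlaneDivAscentB
import Summits.QuantumAdvantage.QuantumAdvantage.Theorems.CharDialPlaneDivAscentC3
import HarnessLib

/-!
# PlaneDivAscent — PART D1: hyperplane ascent and DIMENSION ELIMINATION for plane-divisible sets
(cell decomp-qadv, lens 6 «barrier-complement carving», g21 REV2; tree-ready, Prop-definition-free;
needs Part B (`finrank_le_of_band`, `dvd_lineCount_of_period`, slices) and Part C (`HL.hl_abstract`).)

Setting as in Parts A/B: `W ≤ 𝔽_pⁿ`, `S : Finset`, "plane-divisible in `W`" = `S ⊆ W` and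
`p ∣ planeCount S x a b` for all `x a b ∈ W`; `perIn W S` = the period space; the CODIMENSION LAW `K`
reads `finrank W ≤ finrank (perIn W S) + K` ("`S` is a cylinder over `≤ K` coordinates").

★ `law_iff_succ K`: for fixed `p` and ambient `n`, the codimension law `K` for ALL subspaces `W ≤ 𝔽_pⁿ`
is EQUIVALENT to: every plane-divisible set in a subspace of dimension EXACTLY `K + 1` has a nonzero
period.  (Part B reached the band `K < dim W ≤ (p-1)K + 1` with parallel slabs; here the band collapses
to the single dimension `K + 1`.)  At `K = 3`: «every plane-divisible `S` in a `4`-dimensional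
`𝔽_p`-space has a nonzero period» ⇒ «every plane-divisible `S ⊆ W ≤ 𝔽_pⁿ` is a cylinder over `≤ 3`
coordinates of `W`», for every `n` (`finrank_le_three_of_dim_four`; census form over `𝔽_p⁴` itself:
`finrank_le_three_of_top_four`, via the transport `exists_period_of_top`; all-`n` form `law_iff_top`) — so ONE
finite instance per prime (at `p = 5`: subsets of `𝔽₅⁴`, census K44-general) decides the field core
`K_field(p) ≤ 3` of the second structure law.

Mechanism (`exists_period_of_hyper`).  For `d ∈ W` let `F_d(y) = #{s : y + s•d ∈ S} (mod p)`
(`lineCount`).  Plane-divisibility says `F_d` has ALL LINE SUMS ZERO on `W`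
(`sum_lineCount_eq_planeCount`); `d` is a period iff `F_d ≡ 0` on `W` (`isPeriod_of_lineCount_cast`);
a period `d` of the slab of `S` on the affine hyperplane `{β = 1}` (`slab`, `slabPer`, over the
coordinate functionals `cfun β`, `β ≠ 0`) makes `F_d` vanish there (`dvd_lineCount_of_mem_slabPer`).
If `dim W ≥ K + 2`, the law one dimension down gives `dim slabPer ≥ 1`, i.e. `≥ p - 1` nonzero slab
periods for each of the `p^m - 1` functionals; double counting over the `p^m - 1` nonzero `d ∈ W` yields
one `d` that is a slab period for `≥ p - 1` DISTINCT `β`, and the hyperplane lemma (Part C) forces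
`F_d ≡ 0`, i.e. `d` is a period.
-/

set_option autoImplicit false

namespace Summit.QuantumAdvantage.AdviceFreeQNC0.PlaneDiv

open Finset Module

variable {p : ℕ} [Fact p.Prime] {n : ℕ}

/-! ## Line counts and the function `F_d` -/

/-- Number of points of `S` on the parametrised line `y + ⟨d⟩`: `#{s : y + s•d ∈ S}`. -/
def lineCount (S : Finset (Fin n → ZMod p)) (d y : Fin n → ZMod p) : ℕ :=
  (Finset.univ.filter fun s : ZMod p => y + s • d ∈ S).card

/-- A line count is at most `p`. -/
theorem lineCount_le (S : Finset (Fin n → ZMod p)) (d y : Fin n → ZMod p) : lineCount S d y ≤ p := by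
  unfold lineCount
  calc _ ≤ (Finset.univ : Finset (ZMod p)).card := Finset.card_filter_le _ _
    _ = p := by rw [Finset.card_univ, ZMod.card]

/-- Line counts along `d` summed over a transversal line give the parametrised plane count. -/
theorem sum_lineCount_eq_planeCount (S : Finset (Fin n → ZMod p)) (y e d : Fin n → ZMod p) :
    ∑ s : ZMod p, lineCount S d (y + s • e) = planeCount S y e d := by
  unfold lineCount planeCount
  simp only [Finset.card_filter]
  rw [Fintype.sum_prod_type]

/-- A line count divisible by `p` is `0` or `p`: the line is in or out. -/
theorem mem_iff_of_dvd_lineCount {T : Finset (Fin n → ZMod p)} {d y : Fin n → ZMod p}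
    (h : p ∣ lineCount T d y) : (y ∈ T ↔ y + d ∈ T) := by
  have hle := lineCount_le T d y
  by_cases hzero : lineCount T d y = 0
  · have hnot : ∀ s : ZMod p, y + s • d ∉ T := by
      intro s hs
      have hmem : s ∈ (Finset.univ.filter fun s : ZMod p => y + s • d ∈ T) :=
        Finset.mem_filter.mpr ⟨Finset.mem_univ s, hs⟩
      unfold lineCount at hzero
      rw [Finset.card_eq_zero.mp hzero] at hmem
      simp at hmem
    have h1 := hnot 0
    have h2 := hnot 1
    simp only [zero_smul, add_zero] at h1
    simp only [one_smul] at h2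
    simp [h1, h2]
  · have hcp : lineCount T d y = p := by
      have := Nat.le_of_dvd (Nat.pos_of_ne_zero hzero) h
      omega
    have huniv : (Finset.univ.filter fun s : ZMod p => y + s • d ∈ T) = Finset.univ :=
      Finset.eq_univ_of_card _ (by rw [ZMod.card]; exact hcp)
    have hall : ∀ s : ZMod p, y + s • d ∈ T := fun s => by
      have hmem : s ∈ (Finset.univ.filter fun s : ZMod p => y + s • d ∈ T) := by
        rw [huniv]; exact Finset.mem_univ s
      exact (Finset.mem_filter.mp hmem).2
    have h1 := hall 0
    have h2 := hall 1
    simp only [zero_smul, add_zero] at h1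
    simp only [one_smul] at h2
    simp [h1, h2]

/-- If `F_d` vanishes on `W ⊇ S` (`d ∈ W`), then `d` is a period of `S`. -/
theorem isPeriod_of_lineCount_cast {W : Submodule (ZMod p) (Fin n → ZMod p)}
    {S : Finset (Fin n → ZMod p)} {d : Fin n → ZMod p} (hSW : ∀ x ∈ S, x ∈ W) (hd : d ∈ W)
    (h : ∀ y ∈ W, (lineCount S d y : ZMod p) = 0) : ∀ y, y ∈ S ↔ y + d ∈ S := by
  intro y
  by_cases hy : y ∈ W
  · exact mem_iff_of_dvd_lineCount ((ZMod.natCast_eq_zero_iff _ _).mp (h y hy))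
  · have h1 : y ∉ S := fun h' => hy (hSW y h')
    have h2 : y + d ∉ S := by
      intro h'
      have := W.sub_mem (hSW _ h') hd
      simp at this
      exact hy this
    simp [h1, h2]

/-! ## Coordinate functionals on `W`, their kernels, base points and slabs -/

section Hyper

variable (W : Submodule (ZMod p) (Fin n → ZMod p))

/-- The functional on `W` with coefficient vector `β` in the basis `Module.finBasis`. -/
noncomputable def cfun (β : Fin (finrank (ZMod p) W) → ZMod p) : W →ₗ[ZMod p] ZMod p where
  toFun w := ∑ i, β i * (Module.finBasis (ZMod p) W).repr w i
  map_add' x y := by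
    simp only [map_add, Finsupp.coe_add, Pi.add_apply, mul_add, Finset.sum_add_distrib]
  map_smul' c x := by
    simp only [map_smul, Finsupp.coe_smul, Pi.smul_apply, smul_eq_mul, RingHom.id_apply,
      Finset.mul_sum]
    refine Finset.sum_congr rfl fun i _ => ?_
    ring

/-- Unfolding of `cfun`. -/
theorem cfun_apply (β : Fin (finrank (ZMod p) W) → ZMod p) (w : W) :
    cfun W β w = ∑ i, β i * (Module.finBasis (ZMod p) W).repr w i := rfl

/-- `cfun β` evaluated at the `j`-th basis vector is `β j`. -/
theorem cfun_basis (β : Fin (finrank (ZMod p) W) → ZMod p) (j : Fin (finrank (ZMod p) W)) :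
    cfun W β (Module.finBasis (ZMod p) W j) = β j := by
  rw [cfun_apply, Basis.repr_self]
  simp [Finsupp.single_apply]

/-- `β ↦ cfun β` is injective. -/
theorem cfun_injective {β β' : Fin (finrank (ZMod p) W) → ZMod p} (h : cfun W β = cfun W β') :
    β = β' := by
  funext j
  rw [← cfun_basis W β j, ← cfun_basis W β' j, h]

/-- A nonzero coefficient vector gives a nonzero functional. -/
theorem cfun_ne_zero {β : Fin (finrank (ZMod p) W) → ZMod p} (hβ : β ≠ 0) : cfun W β ≠ 0 := by
  obtain ⟨j, hj⟩ := Function.ne_iff.mp hβ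
  intro h
  apply hj
  have := cfun_basis W β j
  rw [h, LinearMap.zero_apply] at this
  exact this.symm

/-- A nonzero functional takes the value `1`. -/
theorem exists_cfun_eq_one {β : Fin (finrank (ZMod p) W) → ZMod p} (hβ : β ≠ 0) :
    ∃ x : W, cfun W β x = 1 := by
  obtain ⟨j, hj⟩ := Function.ne_iff.mp hβ
  refine ⟨(β j)⁻¹ • Module.finBasis (ZMod p) W j, ?_⟩
  rw [map_smul, cfun_basis, smul_eq_mul, inv_mul_cancel₀ hj]

open Classical in
/-- A base point of the affine hyperplane `{cfun β = 1}` (junk `0` if `β = 0`). -/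
noncomputable def bpt (β : Fin (finrank (ZMod p) W) → ZMod p) : W :=
  if h : ∃ x : W, cfun W β x = 1 then Classical.choose h else 0

/-- The base point lies on the affine hyperplane `{cfun β = 1}` (`β ≠ 0`). -/
theorem cfun_bpt {β : Fin (finrank (ZMod p) W) → ZMod p} (hβ : β ≠ 0) : cfun W β (bpt W β) = 1 := by
  unfold bpt
  rw [dif_pos (exists_cfun_eq_one W hβ)]
  exact Classical.choose_spec (exists_cfun_eq_one W hβ)

/-- The kernel hyperplane of `cfun β`, as a subspace of the ambient space. -/
noncomputable def kerSub (β : Fin (finrank (ZMod p) W) → ZMod p) :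
    Submodule (ZMod p) (Fin n → ZMod p) :=
  (LinearMap.ker (cfun W β)).map W.subtype

/-- The kernel hyperplane lies in `W`. -/
theorem kerSub_le (β : Fin (finrank (ZMod p) W) → ZMod p) : kerSub W β ≤ W := by
  intro x hx
  obtain ⟨y, _, rfl⟩ := Submodule.mem_map.mp hx
  exact y.2

/-- Membership in the kernel hyperplane, for points of `W`. -/
theorem mem_kerSub_iff (β : Fin (finrank (ZMod p) W) → ZMod p) (x : W) :
    (x : Fin n → ZMod p) ∈ kerSub W β ↔ cfun W β x = 0 := by
  constructor
  · intro hx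
    obtain ⟨y, hy, hyx⟩ := Submodule.mem_map.mp hx
    have : y = x := Subtype.ext hyx
    rw [← this]
    exact LinearMap.mem_ker.mp hy
  · intro h
    exact Submodule.mem_map.mpr ⟨x, LinearMap.mem_ker.mpr h, rfl⟩

/-- The kernel hyperplane of a nonzero functional has codimension `1` in `W`. -/
theorem finrank_kerSub {β : Fin (finrank (ZMod p) W) → ZMod p} (hβ : β ≠ 0) :
    finrank (ZMod p) (kerSub W β) + 1 = finrank (ZMod p) W := by
  unfold kerSub
  rw [Submodule.finrank_map_subtype_eq]
  have key := LinearMap.finrank_range_add_finrank_ker (cfun W β)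
  have hsurj : Function.Surjective (cfun W β) := by
    intro c
    refine ⟨c • bpt W β, ?_⟩
    rw [map_smul, cfun_bpt W hβ, smul_eq_mul, mul_one]
  rw [LinearMap.range_eq_top.mpr hsurj, finrank_top, Module.finrank_self] at key
  omega

variable (S : Finset (Fin n → ZMod p))

/-- The slab of `S` on the affine hyperplane `{cfun β = 1}`, translated into the kernel hyperplane. -/
noncomputable def slab (β : Fin (finrank (ZMod p) W) → ZMod p) : Finset (Fin n → ZMod p) :=
  slice (kerSub W β) S (bpt W β : Fin n → ZMod p) 1

/-- The period space of the slab. -/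
noncomputable def slabPer (β : Fin (finrank (ZMod p) W) → ZMod p) :
    Submodule (ZMod p) (Fin n → ZMod p) :=
  perIn (kerSub W β) (slab W S β)

/-- Slab periods lie in `W`. -/
theorem slabPer_le (β : Fin (finrank (ZMod p) W) → ZMod p) : slabPer W S β ≤ W :=
  le_trans (perIn_le _ _) (kerSub_le W β)

/-- Slabs lie in the kernel hyperplane. -/
theorem slab_subset (β : Fin (finrank (ZMod p) W) → ZMod p) : ∀ y ∈ slab W S β, y ∈ kerSub W β :=
  slice_subset _ _ _ _

/-- Slabs of a plane-divisible set are plane-divisible in the kernel hyperplane. -/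
theorem dvd_planeCount_slab {W : Submodule (ZMod p) (Fin n → ZMod p)} {S : Finset (Fin n → ZMod p)}
    (hdiv : ∀ x ∈ W, ∀ a ∈ W, ∀ b ∈ W, p ∣ planeCount S x a b)
    (β : Fin (finrank (ZMod p) W) → ZMod p) :
    ∀ x ∈ kerSub W β, ∀ a ∈ kerSub W β, ∀ b ∈ kerSub W β, p ∣ planeCount (slab W S β) x a b :=
  dvd_planeCount_slice hdiv (kerSub_le W β) (bpt W β).2 1

/-- A slab period makes every line count along it on the hyperplane `{cfun β = 1}` divisible by `p`. -/
theorem dvd_lineCount_of_mem_slabPer {W : Submodule (ZMod p) (Fin n → ZMod p)}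
    {S : Finset (Fin n → ZMod p)} {β : Fin (finrank (ZMod p) W) → ZMod p} (hβ : β ≠ 0)
    {d : Fin n → ZMod p} (hd : d ∈ slabPer W S β) (w : W) (hw : cfun W β w = 1) :
    p ∣ lineCount S d w := by
  have hdK : d ∈ kerSub W β := (mem_perIn.mp hd).1
  have hper : ∀ x, x ∈ slab W S β ↔ x + d ∈ slab W S β := (mem_perIn.mp hd).2
  have hh : ((w - bpt W β : W) : Fin n → ZMod p) ∈ kerSub W β := by
    rw [mem_kerSub_iff]
    rw [map_sub, hw, cfun_bpt W hβ, sub_self]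
  have heq : lineCount S d w = lineCount (slab W S β) d ((w - bpt W β : W) : Fin n → ZMod p) := by
    unfold lineCount
    congr 1
    apply Finset.filter_congr
    intro s _
    unfold slab
    rw [mem_slice]
    have hmem : ((w - bpt W β : W) : Fin n → ZMod p) + s • d ∈ kerSub W β :=
      (kerSub W β).add_mem hh ((kerSub W β).smul_mem s hdK)
    have hpt : ((w - bpt W β : W) : Fin n → ZMod p) + s • d + (1 : ZMod p) • (bpt W β : Fin n → ZMod p)
        = (w : Fin n → ZMod p) + s • d := by
      rw [one_smul, Submodule.coe_sub]
      abel
    simp only [hmem, true_and, hpt]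
  rw [heq]
  exact dvd_lineCount_of_period hper _

end Hyper

end Summit.QuantumAdvantage.AdviceFreeQNC0.PlaneDiv
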